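/-
Copyright (c) 2026 the pub-hodgecm-mathlib formalisation cell (harness21).  Prover seat hodgecm-mathlib-LH4-p04 (g4), req620 Track A «(D-RAM) FOUR-FRAME» squad
(unit U2H_HSide, the (ρ2b′-X) payer road; payer LH4-p14 (g4) hand (C4) «T5s-RamK ∕ RamM» 05:05:59Z; letters of record = F0P3-p01 (g32) T5b «TORIC LEVEL CENSUS, TYPE RamK»
sheet v4 §2 ∕ §2b ∕ §7 + ★ p857459 `QuadraticOrderNormDepthIndexRamK` ∕ ★ p857489 `F0P3cDyRamToricLevelCensusRamK`; dealer∕pen LH4-plan (g12); heir LEAD F0P3a-plan (g20) T19-05 (1)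
«class-keyed level letter: RK `2n_H = jλ − d`»).  2026-09-04.
-/
import Summits.HodgeConjecture.HodgeConjecture.Theorems.F0P3cDyRamToricCensusSumRamKParts   -- FILE 1 (this seat): `tables_diff_ramK`, `col_zero_ramK`, `col_pos_ramK`, `genBlock_mul`, `topBlock_mul`
import HarnessLib

/-!
# Crux `H413`, line LH4 «(D-RAM) FOUR-FRAME» road — unit U2H (ii-H), the (ρ2b′-X) payer: O-Sum ∕ T5s «TORIC CENSUS SUM», TYPE RamK — FILE 2∕2 «THE IDENTITY»:
# `ε·Σ_{j ≤ jl} Σ_a q^a (dep₊(j,a) − dep₋(j,a)) = q^m·(2[n_H + 1]_q − 2[S]_q)`, `2n_H = jl − d`, `S = d − d%2`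

Cell `hodgecm-mathlib` (D-0151), FLOOR 0, crux item H413 = `stmt-HodgeConjecture-24833`, route of record `HCCMUnconditional`; squad F0∕P3c∕LH4 (req618∕req620); registered stub
served: `F0P3cDyRamFourFrameU2H.stub_U2H_fixedPointCensus_typeTwo_unit0` ((ρ2b′-X), tree `Cruxes/H413/Lines/F0_P3c_DyRamFourFrame_U2H_HSide.lean` :418), organ O-Sum ∕ T5s
(payer lineage LH4-p14, HEAD-OF-ORGANS MAP v1 seam S7 «RK∕RM twins PENDING (LH4-p04)»; S7 consumes it as `(q−1)·Σ = ε·q^m·(2q^{n_H+1} − 2q^S)`-shape with `Y_RK = 2[n_H+1]_q`),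
type RamK.  THEOREMS ONLY (no `def`, no instance, no notation, no `sorry`, default heartbeats); lane `--supports stmt-HodgeConjecture-24833 --as helper` (count-neutral).

THE STATEMENT (HEAD BYTES v1 posted first 05:5xZ, `F0/P3c/LH4/LH4-p04/g4/t5s/ToricCensusSumRamK.HEAD.v1.LH4p04g4.lean.txt` 3d92f2c2187db4e9; validated by the Lean-ℕ-semantics twin
`head_twin_ramK.v1.LH4p04g4.py` 7b0ce8904f288cff: 2652∕2652 tuples, q ≤ 8, 2 ≤ d ≤ 8, jl ≤ 22, all m, ε = ±1).  LETTERS: `hnP ∕ hnM` = sheet v4 §2 ℕ-ite RHS VERBATIM (cast);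
`hvGen ∕ hvOff` = sheet v4 §2b (D1)(D2) token for token; `hvTop` = (D3) `|G_j|∕I(c′)` in value form `(if j + a + 2 ≤ m + 2d then 1 else 2)·q^{j − (j+a−m+1)∕2}` with the alive
law `2j + d ≤ 2jl + 1 ∧ (j + a + 2 ≤ m + 2d ∨ ε = side)`: the bit is DERIVED (Φ-mechanism of LH4-p08 (g4) T5a v2 §5 in type RK: `M∕K` unramified ⇒ `Φ(M¹_s) = K¹_{s+d−1}` and
`v(λ∕ρλ − 1) = jl` ⇒ `D = jl − d + 1`; = g32 §7 (i)), the side rule is g32 §7 (ii).  The token window of `ε = −1` (`jl + 2 ≤ m + 2d`, i.e. `ℓ = jl − m ≤ 2d − 2`) is forced: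
for `ℓ ≥ 2d` the K♮-part of `μ` lies in `𝒪_F^×U_{K♮}^{(ℓ∕2)} ⊆ N_{M∕K♮}(𝒪_M^×)` and the anisotropic class is dead (there the identity with `ε = −1` is false, e.g. `(q,d,jl,m) =
(2,2,10,4)`: `8 ≠ 56`) — realizability (S6b-RK) must land inside `hε`.
PROOF = FILE 1: columns first (`Finset.sum_comm`); the column `a = 0` is `2x^d[⌊jl∕2⌋+1−d]`, a column `a ≥ 1` is `[2a ≤ m ∧ d + a ≤ ⌊jl∕2⌋ + 1]·(2x^{⌊jl∕2⌋+a} − 2(x+1)x^{2a+d−2})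
+ ε·[window]·2x^{⌊jl∕2⌋+a}`; two window re-indexings, one multiplication by `x − 1`, `ring` in the atoms `x^{⌈m∕2⌉−⌊d∕2⌋}, x^{⌊d∕2⌋−1}, x^{⌊jl∕2⌋−⌊m∕2⌋−d}, x` per parity of `d`
(regime `ε = +1`), resp. `A = 0` and `B = RHS` directly (the `ε = −1` window, where `ε² = 1`).
HONEST LABEL.  Count-neutral (`--supports`); nothing printed is asserted; (ρ2b′-X) `stub_U2H_fixedPointCensus_typeTwo_unit0` (U2H :418) stays a PROVER TARGET (an empirical
census law, kit-confirmed; (R-25): organ road measured at `tE = 2`) until its payer lands; `HC_CM` is proved only modulo the 7 printed citations (2 remaining named inputs: hLiu418 =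
`stmt-HodgeConjecture-24832`, h413 = `stmt-HodgeConjecture-24833`) until rung 0 closes.

## References
* [Kottwitz1986BaseChangeUnits] R. E. Kottwitz, *Base change for unit elements of Hecke algebras*, Compositio Math. 60 (1986), §1 pp. 240–241 (orbital integrals of units as
  lattice counts modulo the torus).
* [Rogawski1990] J. D. Rogawski, *Automorphic Representations of Unitary Groups in Three Variables*, Ann. of Math. Stud. 123 (1990), §4.9 Prop. 4.9.1 (b) p. 55, Lemma 4.9.3 p. 56
  (the fixed-point census of a type-(2) element; the toric decomposition).
* [Flicker1998UnitaryFL] Y. Z. Flicker, *Elementary proof of the fundamental lemma for a unitary group*, Canad. J. Math. 50 (1998): Prop. 7 p. 84 (the level tables).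
-/

set_option autoImplicit false

namespace Summit.HodgeConjecture.HodgeConjecture.Cruxes.H413.F0P3cDyRamToricCensusSumRamK

open Finset
open Summit.HodgeConjecture.HodgeConjecture.Cruxes.H413.F0P3cDyRamToricCensusSumUnrBlocks (sum_range_window_reindex geom_sum_mul')
open Summit.HodgeConjecture.HodgeConjecture.Cruxes.H413.F0P3cDyRamToricCensusSumRamKParts

/-- **O-SUM ∕ T5s, TYPE RamK («K∕F RAMIFIED, THIRD FIELD K♮∕F UNRAMIFIED») — THE TORIC CENSUS SUM.**  Let `nP nM : ℕ → ℕ → ℚ` be the u-FREE LEVEL TABLES of type RamK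
(F0P3-p01 (g32) T5b sheet v4 §2 `ncard_levelSet_ramK_hyper ∕ _aniso`, ℕ-valued and cast: hyperbolic `q^j ∣ δ(j)q^{j∕2} ∣ (q−1)q^{j−1−c∕2} ∣ (q−2)q^{j−d} ∣ 2(q−1)q^{j−1−c∕2}`,
anisotropic `q^j ∣ [j ≤ 2d−2]q^{j∕2} ∣ (q−1)q^{j−1−c∕2} ∣ q^{j−d+1} ∣ 0` on `a = j ∣ a = 0 ∣ c < 2d−2 ∣ c = 2d−2 ∣ c > 2d−2`, `c = j − a ≡ 0 (2)`) and let `vP vM` follow the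
DEPTH RULES at the tokens `(m, ε)` (sheet v4 §2b: GENERIC cells `a ≤ m ∧ (j + a ≤ m ∨ (2a ≤ m ∧ j + a ≤ jl))` whole, off-diagonal non-generic cells empty, and on the diagonal
`j + m = jl + a` the top cells `|G_j|∕I(c′) = (1∣2)·q^{j−⌈c′∕2⌉}`, `c′ = j + a − m`, alive iff `2j + d ≤ 2jl + 1` and — beyond `c′ ≥ 2d − 1` — only on the side `ε`).  Then for
`q, d ≥ 2`, `jl ≡ d (2)` (the conductor level of `λ`; H-LEVEL BINDER `2n_H = jl − d`), `S := d − d%2 ≤ n_H + 1`, on the token set `m ≡ d (2)`, `S − 1 ≤ m ≤ jl`, `ε = +1` or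
(`ε = −1` and `jl − m ≤ 2d − 2`):  `ε·Σ_{j ≤ jl} Σ_a q^a (vP j a − vM j a) = q^m·(2[n_H + 1]_q − 2[S]_q)` — the O-Sum organ of the (ρ2b′-X) payer, type RK.  Pure finite-sum
bookkeeping over `ℚ`: per column the generic differences telescope (`A = 2q^{2h+d}[⌊jl∕2⌋ − h + 1 − d]`, `h = ⌊m∕2⌋`; zero exactly in the `ε = −1` window) and the one-sided top
cells form one geometric block `B = 2q^{⌊jl∕2⌋}Σ_{a ∈ window} q^a`, `A + B = RHS`.  Statement validated by a Lean-semantics twin (2652 tuples, q ≤ 8, d ≤ 8, jl ≤ 22).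
[cite: Kottwitz1986BaseChangeUnits, §1 pp. 240–241] [cite: Rogawski1990, §4.9 Prop. 4.9.1 (b) p. 55, Lemma 4.9.3 p. 56] [cite: Flicker1998UnitaryFL, Prop. 7 p. 84] -/
theorem toricCensusSum_ramK (q : ℕ) {d jl m : ℕ} (ε : ℚ) (hq : 2 ≤ q) (hd : 2 ≤ d) (hjl : jl % 2 = d % 2) (hjlS : 3 * d ≤ jl + 2 + 2 * (d % 2))
    (hpar : m % 2 = d % 2) (hmS : d - d % 2 ≤ m + 1) (hm : m ≤ jl) (hε : ε = 1 ∨ (ε = -1 ∧ jl + 2 ≤ m + 2 * d))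
    (nP nM vP vM : ℕ → ℕ → ℚ)
    (hnP : ∀ j a, nP j a = ((if j = 0 then (if a = 0 then 1 else 0) else if j < a ∨ (j - a) % 2 = 1 then 0
      else if a = j then (if 2 ≤ d then q ^ j else (q - 1) * q ^ (j - 1)) else if a = 0 then (if 2 * d ≤ j + 1 then 2 else 1) * q ^ (j / 2)
      else if j - a + 2 < 2 * d then (q - 1) * q ^ (j - 1 - (j - a) / 2) else if j - a + 2 = 2 * d then (q - 2) * q ^ (j - d)
      else 2 * (q - 1) * q ^ (j - 1 - (j - a) / 2) : ℕ) : ℚ))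
    (hnM : ∀ j a, nM j a = ((if j = 0 then (if a = 0 then 1 else 0) else if j < a ∨ (j - a) % 2 = 1 then 0
      else if a = j then (if 2 ≤ d then q ^ j else (q + 1) * q ^ (j - 1)) else if a = 0 then (if j + 2 ≤ 2 * d then q ^ (j / 2) else 0)
      else if j - a + 2 < 2 * d then (q - 1) * q ^ (j - 1 - (j - a) / 2) else if j - a + 2 = 2 * d then q ^ (j - d + 1) else 0 : ℕ) : ℚ))
    (hvGen : ∀ j a, (a ≤ m ∧ (j + a ≤ m ∨ (2 * a ≤ m ∧ j + a ≤ jl))) → vP j a = nP j a ∧ vM j a = nM j a)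
    (hvOff : ∀ j a, ¬ (a ≤ m ∧ (j + a ≤ m ∨ (2 * a ≤ m ∧ j + a ≤ jl))) → j + m ≠ jl + a → vP j a = 0 ∧ vM j a = 0)
    (hvTop : ∀ j a, ¬ (a ≤ m ∧ (j + a ≤ m ∨ (2 * a ≤ m ∧ j + a ≤ jl))) → j + m = jl + a →
      (vP j a = if 2 * j + d ≤ 2 * jl + 1 ∧ (j + a + 2 ≤ m + 2 * d ∨ ε = 1) then (if j + a + 2 ≤ m + 2 * d then 1 else 2) * (q : ℚ) ^ (j - (j + a - m + 1) / 2) else 0) ∧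
      (vM j a = if 2 * j + d ≤ 2 * jl + 1 ∧ (j + a + 2 ≤ m + 2 * d ∨ ε = -1) then (if j + a + 2 ≤ m + 2 * d then 1 else 2) * (q : ℚ) ^ (j - (j + a - m + 1) / 2) else 0)) :
    ε * ∑ j ∈ range (jl + 1), ∑ a ∈ range (jl + 2), (q : ℚ) ^ a * (vP j a - vM j a) =
      (q : ℚ) ^ m * (2 * ∑ i ∈ range ((jl - d) / 2 + 1), (q : ℚ) ^ i - 2 * ∑ i ∈ range (d - d % 2), (q : ℚ) ^ i) := by
  set x : ℚ := (q : ℚ) with hxq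
  have hx1 : x ≠ 1 := by rw [hxq]; exact_mod_cast (show q ≠ 1 by omega)
  have hε' : ε = 1 ∨ ε = -1 := hε.imp_right And.left
  have hεε : ε * ε = 1 := by rcases hε' with rfl | rfl <;> norm_num
  have hδ : ∀ j a, nP j a - nM j a = if a ≤ j ∧ (j - a) % 2 = 0 then
      (if a = 0 then (if 2 * d ≤ j then 2 * x ^ (j / 2) else 0)
       else if a < j then (if j - a + 2 = 2 * d then -2 * x ^ (j - d) else if 2 * d < j - a + 2 then 2 * (x - 1) * x ^ (j - 1 - (j - a) / 2) else 0)
       else 0) else 0 := fun j a => by rw [hnP, hnM]; exact tables_diff_ramK q hq hd j a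
  -- columns first
  rw [Finset.sum_comm, Finset.sum_range_succ', col_zero_ramK x nP nM vP vM hδ hvGen,
    Finset.sum_congr rfl (fun a _ => col_pos_ramK x ε hε' hd hm nP nM vP vM hδ hvGen hvOff hvTop (show 1 ≤ a + 1 by omega)),
    Finset.sum_add_distrib, ← Finset.mul_sum]
  -- the RHS, multiplied by `x − 1`
  have hR : (x - 1) * (x ^ m * (2 * ∑ i ∈ range ((jl - d) / 2 + 1), x ^ i - 2 * ∑ i ∈ range (d - d % 2), x ^ i)) =
      2 * x ^ m * (x ^ ((jl - d) / 2 + 1) - x ^ (d - d % 2)) := by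
    have h1 := geom_sum_mul' x ((jl - d) / 2 + 1)
    have h2 := geom_sum_mul' x (d - d % 2)
    linear_combination (2 * x ^ m) * h1 - (2 * x ^ m) * h2
  -- the column `a = 0`, multiplied by `x − 1`
  have hC0 : (x - 1) * (2 * x ^ d * ∑ k ∈ range (jl / 2 + 1 - d), x ^ k) = 2 * x ^ d * (x ^ (jl / 2 + 1 - d) - 1) := by
    have h1 := geom_sum_mul' x (jl / 2 + 1 - d)
    linear_combination (2 * x ^ d) * h1
  by_cases hreg : jl + 2 ≤ m + 2 * d
  · ---------------------------------------------------------------- the window `ℓ ≤ 2d − 2`: the generic part cancels, the top cells give everything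
    -- generic columns: `a + 1 ≤ ⌊jl∕2⌋ + 1 − d`
    have hG : ∀ a ∈ range (jl + 1), (if 2 * (a + 1) ≤ m ∧ 2 * d + 2 * (a + 1) ≤ jl + 2 then 2 * x ^ (jl / 2 + (a + 1)) - 2 * (x + 1) * x ^ (2 * (a + 1) + d - 2) else 0) =
        (if 0 ≤ a ∧ a < 0 + (jl / 2 + 1 - d) then 2 * x ^ (jl / 2 + 1) * x ^ a - 2 * (x + 1) * x ^ d * x ^ (2 * a) else 0) := by
      intro a _
      by_cases h : 2 * (a + 1) ≤ m ∧ 2 * d + 2 * (a + 1) ≤ jl + 2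
      · rw [if_pos h, if_pos (by omega), show jl / 2 + (a + 1) = (jl / 2 + 1) + a by omega, pow_add, show 2 * (a + 1) + d - 2 = d + 2 * a by omega, pow_add]; ring
      · rw [if_neg h, if_neg (by omega)]
    -- top cells: `m + S − ⌊jl∕2⌋ ≤ a + 1 ≤ m − ⌊d∕2⌋`
    have hT : ∀ a ∈ range (jl + 1), (if m < 2 * (a + 1) ∧ 2 * (a + 1) + d ≤ 2 * m + 1 ∧ 2 * m + 2 * d ≤ jl + 2 * (a + 1) + 1 then 2 * x ^ (jl / 2 + (a + 1)) else 0) =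
        (if (m + (d - d % 2) - jl / 2 - 1) ≤ a ∧ a < (m + (d - d % 2) - jl / 2 - 1) + ((jl - d) / 2 + 1 - (d - d % 2)) then 2 * x ^ (m + (d - d % 2)) * x ^ (a - (m + (d - d % 2) - jl / 2 - 1)) else 0) := by
      intro a _
      by_cases h : m < 2 * (a + 1) ∧ 2 * (a + 1) + d ≤ 2 * m + 1 ∧ 2 * m + 2 * d ≤ jl + 2 * (a + 1) + 1
      · rw [if_pos h, if_pos (by omega), show jl / 2 + (a + 1) = (m + (d - d % 2)) + (a - (m + (d - d % 2) - jl / 2 - 1)) by omega, pow_add, ← mul_assoc]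
      · rw [if_neg h, if_neg (by omega)]
    rw [Finset.sum_congr rfl hG, sum_range_window_reindex (fun a => 2 * x ^ (jl / 2 + 1) * x ^ a - 2 * (x + 1) * x ^ d * x ^ (2 * a)) (show 0 + (jl / 2 + 1 - d) ≤ jl + 1 by omega),
      Finset.sum_congr rfl hT, sum_range_window_reindex (fun a => 2 * x ^ (m + (d - d % 2)) * x ^ (a - (m + (d - d % 2) - jl / 2 - 1)))
        (show (m + (d - d % 2) - jl / 2 - 1) + ((jl - d) / 2 + 1 - (d - d % 2)) ≤ jl + 1 by omega)]
    simp_rw [zero_add, Nat.add_sub_cancel_left]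
    have hA : (x - 1) * (∑ i ∈ range (jl / 2 + 1 - d), (2 * x ^ (jl / 2 + 1) * x ^ i - 2 * (x + 1) * x ^ d * x ^ (2 * i)) + 2 * x ^ d * ∑ k ∈ range (jl / 2 + 1 - d), x ^ k) = 0 := by
      rw [mul_add, genBlock_mul, hC0]
      have f1 : x ^ (jl / 2 + 1) = x ^ (jl / 2 + 1 - d) * x ^ d := by rw [← pow_add]; congr 1; omega
      have f2 : x ^ (2 * (jl / 2 + 1 - d)) = x ^ (jl / 2 + 1 - d) * x ^ (jl / 2 + 1 - d) := by rw [← pow_add]; congr 1; omega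
      rw [f1, f2]; ring
    have hA' : ∑ i ∈ range (jl / 2 + 1 - d), (2 * x ^ (jl / 2 + 1) * x ^ i - 2 * (x + 1) * x ^ d * x ^ (2 * i)) + 2 * x ^ d * ∑ k ∈ range (jl / 2 + 1 - d), x ^ k = 0 := by
      rcases mul_eq_zero.1 hA with h | h
      · exact absurd (sub_eq_zero.1 h) hx1
      · exact h
    have hB : (x - 1) * ∑ i ∈ range ((jl - d) / 2 + 1 - (d - d % 2)), 2 * x ^ (m + (d - d % 2)) * x ^ i =
        (x - 1) * (x ^ m * (2 * ∑ i ∈ range ((jl - d) / 2 + 1), x ^ i - 2 * ∑ i ∈ range (d - d % 2), x ^ i)) := by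
      rw [topBlock_mul, hR]
      have f1 : x ^ ((jl - d) / 2 + 1) = x ^ (d - d % 2) * x ^ ((jl - d) / 2 + 1 - (d - d % 2)) := by rw [← pow_add]; congr 1; omega
      rw [pow_add, f1]; ring
    have hB' := mul_left_cancel₀ (sub_ne_zero.2 hx1) hB
    rw [show ε * (∑ i ∈ range (jl / 2 + 1 - d), (2 * x ^ (jl / 2 + 1) * x ^ i - 2 * (x + 1) * x ^ d * x ^ (2 * i)) +
          ε * ∑ i ∈ range ((jl - d) / 2 + 1 - (d - d % 2)), 2 * x ^ (m + (d - d % 2)) * x ^ i + 2 * x ^ d * ∑ k ∈ range (jl / 2 + 1 - d), x ^ k) =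
        ε * (∑ i ∈ range (jl / 2 + 1 - d), (2 * x ^ (jl / 2 + 1) * x ^ i - 2 * (x + 1) * x ^ d * x ^ (2 * i)) + 2 * x ^ d * ∑ k ∈ range (jl / 2 + 1 - d), x ^ k) +
        ε * ε * ∑ i ∈ range ((jl - d) / 2 + 1 - (d - d % 2)), 2 * x ^ (m + (d - d % 2)) * x ^ i by ring,
      hA', hεε, mul_zero, zero_add, one_mul, hB']
  · ---------------------------------------------------------------- `ℓ ≥ 2d`: `ε = +1`, generic columns `a + 1 ≤ ⌊m∕2⌋`, top cells `⌊m∕2⌋ + 1 ≤ a + 1 ≤ m − ⌊d∕2⌋`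
    have hε1 : ε = 1 := by rcases hε with h | ⟨_, h⟩; exact h; exact absurd h hreg
    subst hε1
    have hG : ∀ a ∈ range (jl + 1), (if 2 * (a + 1) ≤ m ∧ 2 * d + 2 * (a + 1) ≤ jl + 2 then 2 * x ^ (jl / 2 + (a + 1)) - 2 * (x + 1) * x ^ (2 * (a + 1) + d - 2) else 0) =
        (if 0 ≤ a ∧ a < 0 + m / 2 then 2 * x ^ (jl / 2 + 1) * x ^ a - 2 * (x + 1) * x ^ d * x ^ (2 * a) else 0) := by
      intro a _
      by_cases h : 2 * (a + 1) ≤ m ∧ 2 * d + 2 * (a + 1) ≤ jl + 2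
      · rw [if_pos h, if_pos (by omega), show jl / 2 + (a + 1) = (jl / 2 + 1) + a by omega, pow_add, show 2 * (a + 1) + d - 2 = d + 2 * a by omega, pow_add]; ring
      · rw [if_neg h, if_neg (by omega)]
    have hT : ∀ a ∈ range (jl + 1), (if m < 2 * (a + 1) ∧ 2 * (a + 1) + d ≤ 2 * m + 1 ∧ 2 * m + 2 * d ≤ jl + 2 * (a + 1) + 1 then 2 * x ^ (jl / 2 + (a + 1)) else 0) =
        (if m / 2 ≤ a ∧ a < m / 2 + (m - d / 2 - m / 2) then 2 * x ^ (jl / 2 + m / 2 + 1) * x ^ (a - m / 2) else 0) := by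
      intro a _
      by_cases h : m < 2 * (a + 1) ∧ 2 * (a + 1) + d ≤ 2 * m + 1 ∧ 2 * m + 2 * d ≤ jl + 2 * (a + 1) + 1
      · rw [if_pos h, if_pos (by omega), show jl / 2 + (a + 1) = (jl / 2 + m / 2 + 1) + (a - m / 2) by omega, pow_add, ← mul_assoc]
      · rw [if_neg h, if_neg (by omega)]
    rw [Finset.sum_congr rfl hG, sum_range_window_reindex (fun a => 2 * x ^ (jl / 2 + 1) * x ^ a - 2 * (x + 1) * x ^ d * x ^ (2 * a)) (show 0 + m / 2 ≤ jl + 1 by omega),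
      Finset.sum_congr rfl hT, sum_range_window_reindex (fun a => 2 * x ^ (jl / 2 + m / 2 + 1) * x ^ (a - m / 2)) (show m / 2 + (m - d / 2 - m / 2) ≤ jl + 1 by omega)]
    simp_rw [zero_add, Nat.add_sub_cancel_left, one_mul]
    apply mul_left_cancel₀ (sub_ne_zero.2 hx1)
    rw [mul_add, mul_add, genBlock_mul, topBlock_mul, hC0, hR]
    -- atoms: `x^r` (`r = ⌈m∕2⌉ − ⌊d∕2⌋`), `x^t` (`t = ⌊d∕2⌋ − 1`), `x^u` (`u = ⌊jl∕2⌋ − ⌊m∕2⌋ − d`), `x`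
    rcases Nat.mod_two_eq_zero_or_one d with hδ | hδ
    · have f1 : x ^ (jl / 2 + 1) = x ^ (m - d / 2 - m / 2) * x ^ (d / 2 - 1) * x ^ (d / 2 - 1) * x ^ (d / 2 - 1) * x ^ (jl / 2 - m / 2 - d) * x * x * x * x := by
        simp only [← pow_add, ← pow_succ]; congr 1; omega
      have f2 : x ^ (m / 2) = x ^ (m - d / 2 - m / 2) * x ^ (d / 2 - 1) * x := by simp only [← pow_add, ← pow_succ]; congr 1; omega
      have f3 : x ^ d = x ^ (d / 2 - 1) * x ^ (d / 2 - 1) * x * x := by simp only [← pow_add, ← pow_succ]; congr 1; omega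
      have f4 : x ^ (2 * (m / 2)) = x ^ (m - d / 2 - m / 2) * x ^ (m - d / 2 - m / 2) * x ^ (d / 2 - 1) * x ^ (d / 2 - 1) * x * x := by
        simp only [← pow_add, ← pow_succ]; congr 1; omega
      have f5 : x ^ (jl / 2 + m / 2 + 1) = x ^ (m - d / 2 - m / 2) * x ^ (m - d / 2 - m / 2) * x ^ (d / 2 - 1) * x ^ (d / 2 - 1) * x ^ (d / 2 - 1) * x ^ (d / 2 - 1) *
          x ^ (jl / 2 - m / 2 - d) * x * x * x * x * x := by simp only [← pow_add, ← pow_succ]; congr 1; omega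
      have f6 : x ^ (jl / 2 + 1 - d) = x ^ (m - d / 2 - m / 2) * x ^ (d / 2 - 1) * x ^ (jl / 2 - m / 2 - d) * x * x := by
        simp only [← pow_add, ← pow_succ]; congr 1; omega
      have f7 : x ^ m = x ^ (m - d / 2 - m / 2) * x ^ (m - d / 2 - m / 2) * x ^ (d / 2 - 1) * x ^ (d / 2 - 1) * x * x := by
        simp only [← pow_add, ← pow_succ]; congr 1; omega
      have f8 : x ^ ((jl - d) / 2 + 1) = x ^ (m - d / 2 - m / 2) * x ^ (d / 2 - 1) * x ^ (d / 2 - 1) * x ^ (jl / 2 - m / 2 - d) * x * x * x := by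
        simp only [← pow_add, ← pow_succ]; congr 1; omega
      have f9 : x ^ (d - d % 2) = x ^ (d / 2 - 1) * x ^ (d / 2 - 1) * x * x := by simp only [← pow_add, ← pow_succ]; congr 1; omega
      rw [f1, f2, f3, f4, f5, f6, f7, f8, f9]; ring
    · have f1 : x ^ (jl / 2 + 1) = x ^ (m - d / 2 - m / 2) * x ^ (d / 2 - 1) * x ^ (d / 2 - 1) * x ^ (d / 2 - 1) * x ^ (jl / 2 - m / 2 - d) * x * x * x * x := by
        simp only [← pow_add, ← pow_succ]; congr 1; omega
      have f2 : x ^ (m / 2) = x ^ (m - d / 2 - m / 2) * x ^ (d / 2 - 1) := by simp only [← pow_add]; congr 1; omega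
      have f3 : x ^ d = x ^ (d / 2 - 1) * x ^ (d / 2 - 1) * x * x * x := by simp only [← pow_add, ← pow_succ]; congr 1; omega
      have f4 : x ^ (2 * (m / 2)) = x ^ (m - d / 2 - m / 2) * x ^ (m - d / 2 - m / 2) * x ^ (d / 2 - 1) * x ^ (d / 2 - 1) := by
        simp only [← pow_add]; congr 1; omega
      have f5 : x ^ (jl / 2 + m / 2 + 1) = x ^ (m - d / 2 - m / 2) * x ^ (m - d / 2 - m / 2) * x ^ (d / 2 - 1) * x ^ (d / 2 - 1) * x ^ (d / 2 - 1) * x ^ (d / 2 - 1) *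
          x ^ (jl / 2 - m / 2 - d) * x * x * x * x := by simp only [← pow_add, ← pow_succ]; congr 1; omega
      have f6 : x ^ (jl / 2 + 1 - d) = x ^ (m - d / 2 - m / 2) * x ^ (d / 2 - 1) * x ^ (jl / 2 - m / 2 - d) * x := by
        simp only [← pow_add, ← pow_succ]; congr 1; omega
      have f7 : x ^ m = x ^ (m - d / 2 - m / 2) * x ^ (m - d / 2 - m / 2) * x ^ (d / 2 - 1) * x ^ (d / 2 - 1) * x := by
        simp only [← pow_add, ← pow_succ]; congr 1; omega
      have f8 : x ^ ((jl - d) / 2 + 1) = x ^ (m - d / 2 - m / 2) * x ^ (d / 2 - 1) * x ^ (d / 2 - 1) * x ^ (jl / 2 - m / 2 - d) * x * x * x := by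
        simp only [← pow_add, ← pow_succ]; congr 1; omega
      have f9 : x ^ (d - d % 2) = x ^ (d / 2 - 1) * x ^ (d / 2 - 1) * x * x := by simp only [← pow_add, ← pow_succ]; congr 1; omega
      rw [f1, f2, f3, f4, f5, f6, f7, f8, f9]; ring

end Summit.HodgeConjecture.HodgeConjecture.Cruxes.H413.F0P3cDyRamToricCensusSumRamK
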